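import Literature.Algebra.EuclideanLattices.LatticeGapNPcoNP
import Literature.Algebra.EuclideanLattices.GapCVPPrimeMachine
import Literature.Computability.Complexity.NPBoundedQuantifiers
import HarnessLib

/-!
# Aharonov–Regev 2005, Lemma A.1, discharged: `GapCVP_γ ∈ coNP ⟹ GapSVP_γ ∈ coNP`

Topic `Algebra/EuclideanLattices` (family `pqc`), sibling proof file of `LatticeGapNPcoNP.lean`
(D-0014: the named fact `Literature.Algebra.EuclideanLattices.AharonovRegev2005_lemmaA1 : Prop`
stays a `def` there and is discharged here as `AharonovRegev2005_lemmaA1_holds`). This closes the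
second of the three leaves of the decomposition of Aharonov–Regev 2005, Cor. 1.2
(`gapSVP_sqrt_mem_promiseNP_inter_promiseCoNP` of `LatticeComplexity.lean`), so that Cor. 1.2 now
follows from the NP leaf and the coNP part of Thm. 1.1 alone
(`gapSVP_sqrt_mem_promiseNP_inter_promiseCoNP_of_NP_of_coNP`).

## The printed statement and proof

D. Aharonov, O. Regev, *Lattice problems in NP ∩ coNP*, J. ACM 52 (2005); authors' version of
September 8, 2005 (`lit read paper:doi-10-1109-focs-2004-35`), Appendix A, Lemma A.1 (p. 14):
"If for some `β = β(n)`, `GapCVP_β` is in coNP then so is `GapSVP_β`." Printed proof: the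
Goldreich–Micciancio–Safra–Seifert reduction maps `(B, d)` to the `n` instances
`(B⁽ⁱ⁾, bᵢ, d)` of `GapCVP_β` (`B⁽ⁱ⁾` = `B` with the `i`-th basis vector doubled); a YES instance
has some YES image and a NO instance has only NO images, "since a NO witness for `L` can be given
by `n` NO witnesses for `(Lᵢ, bᵢ)`".

## The Lean proof

Everything instance-level and machine-level is already in the tree; this file is the assembly.

* Instance level (`GapCVPPrime.lean`, PROVED): `MicciancioRegev2007_lemma_5_22` — for `n ≠ 0`,
  `(B, d) ∈ GapSVP_γ.YES ↔ ∃ i, (B⁽ⁱ⁾, bᵢ, d) ∈ GapCVP′_γ.YES` and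
  `(B, d) ∈ GapSVP_γ.NO → ∀ i, (B⁽ⁱ⁾, bᵢ, d) ∈ GapCVP′_γ.NO`, with `GapCVP′.YES = GapCVP.YES` and
  `GapCVP′.NO ⊆ GapCVP.NO` (`GapCVP'.yes_eq_gapCVP_yes`, `GapCVP'.no_subset_gapCVP_no`).
* Machine level (`GapCVPPrimeMachine.lean`, PROVED): the total string functions
  `GMSSMachine.qFn ⟨x, T⟩ = 0 · query x (tlen T) (dimOf x)`,
  `GMSSMachine.doneTestFn ⟨x, T⟩ = [dimOf x ≤ tlen T]`, `GMSSMachine.zeroTestFn ⟨x, T⟩ = [dimOf x = 0]`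
  are in `FP`, and on the code `x` of `(B, d)` one has `dimOf x = n` and
  `query x j n = code of ((B⁽ʲ⁾, bⱼ), d)` (`GMSS.dimOf_encode`, `GMSS.query_encode`).
* Class level (`NPBoundedQuantifiers.lean`, `NPClosureProofs.lean`, PROVED): `coNP` is closed under
  polynomially bounded `∃` (`bexLang_mem_coNP`: `{x | ∃ i < q(|x|), ⟨x, 1ⁱ⟩ ∈ A}`), under `FP`
  preimages and under `∩`/`∪` with `P` languages.

Given a `coNP` language `K` separating `GapCVP_γ`, the `coNP` language separating `GapSVP_γ` is
`K' = {x | dimOf x = 0} ∪ {x | ∃ i < |x|, ¬ (dimOf x ≤ i) ∧ query x i (dimOf x) ∈ K}`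
(the index `i` is presented to the machines as the fake transcript `⟨1ⁱ, []⟩`, whose `tlen` is
`i`). On the code of a YES instance of positive dimension some GMSS query is a YES code, hence in
`K`; on the code of a NO instance (positive dimension is forced when `γ(0) ≥ 0`) every in-range
query is a NO code, hence outside `K`, and out-of-range indices are excluded by the range test.
Dimension `0`: for `γ(0) ≥ 0` there is no NO instance and every string with `dimOf x = 0` may be
accepted; for `γ(0) < 0` the YES and NO sets of `GapCVP_γ` meet in dimension `0`
(`exists_mem_gapCVP'_yes_and_no_of_n_eq_zero`), so the hypothesis `GapCVP_γ ∈ PromiseCoNP` is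
contradictory and the lemma holds vacuously — exactly as announced in the docstring of the fact.

## References

* D. Aharonov, O. Regev, *Lattice problems in NP ∩ coNP*, J. ACM 52 (2005) 749–765, Lemma A.1
  (App. A, p. 14 of the authors' version).
* O. Goldreich, D. Micciancio, S. Safra, J.-P. Seifert, *Approximating shortest lattice vectors
  is not harder than approximating closest lattice vectors*, IPL 71 (1999), Thm. 1 / §3.
* D. Micciancio, O. Regev, *Worst-case to average-case reductions based on Gaussian measures*,
  SIAM J. Comput. 37 (2007), Lemma 5.22.
* S. Arora, B. Barak, *Computational Complexity: A Modern Approach*, CUP 2009, §2.1, Ex. 2.10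
  (closure of NP/coNP under bounded quantifiers and polynomial-time preimages).
-/

noncomputable section

open Computability Literature.Computability.Complexity Literature.Computability.Complexity.Nondeterministic

namespace Literature.Algebra.EuclideanLattices

open GMSS GMSSMachine NPBounded Polynomial

/-! ### The index presented as a fake transcript -/

/-- Re-pairing `⟨x, u⟩ ↦ ⟨x, ⟨u, []⟩⟩`: the index `u = 1ⁱ` of a bounded quantifier becomes the
unary header of a transcript code with `tlen = i` (and no recorded answer), the input format of
the GMSS bricks `qFn`, `doneTestFn`. [folklore] -/
def lemmaA1Repair : List Bool → List Bool :=
  pairFn fstP (pairFn sndP fun _ => [])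

/-- `lemmaA1Repair ∈ FP`. [folklore] -/
theorem lemmaA1Repair_mem_FP : lemmaA1Repair ∈ FP :=
  pairFn_mem_FP fstP_mem_FP (pairFn_mem_FP sndP_mem_FP (const_mem_FP _))

/-- Value of `lemmaA1Repair` on a pair. [folklore] -/
@[simp] theorem lemmaA1Repair_boolPair (x u : List Bool) :
    lemmaA1Repair (boolPair x u) = boolPair x (boolPair u []) := by
  simp [lemmaA1Repair]

/-- The transcript length of the fake transcript `⟨u, []⟩` is `|u|`. [folklore] -/
@[simp] theorem tlen_boolPair_nil (u : List Bool) : tlen (boolPair u []) = u.length := by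
  simp [tlen]

/-- **The GMSS query map as an `FP` string function of (input, unary index)**:
`lemmaA1QueryFn ⟨x, u⟩ = query x |u| (dimOf x)` (`List.tail` strips the tag bit of `qFn`).
[cite: GoldreichMicciancioSafraSeifert1999, §3] -/
def lemmaA1QueryFn : List Bool → List Bool :=
  List.tail ∘ qFn ∘ lemmaA1Repair

/-- `lemmaA1QueryFn ∈ FP`. [cite: AroraBarak2009, §1.3 (polynomial time is closed under composition)] -/
theorem lemmaA1QueryFn_mem_FP : lemmaA1QueryFn ∈ FP :=
  comp_mem_FP PRelSigma.tail_mem_FP (comp_mem_FP qFn_mem_FP lemmaA1Repair_mem_FP)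

/-- Value of the query map on a pair. [cite: GoldreichMicciancioSafraSeifert1999, §3] -/
@[simp] theorem lemmaA1QueryFn_boolPair (x u : List Bool) :
    lemmaA1QueryFn (boolPair x u) = query x u.length (dimOf x) := by
  simp [lemmaA1QueryFn, qFn]

/-- On the code of `(B, d)` and the index `1ⁱ`, `i < n`, the query map returns the code of the
`i`-th GMSS instance `((B⁽ⁱ⁾, bᵢ), d)`. [cite: GoldreichMicciancioSafraSeifert1999, §3] -/
theorem lemmaA1QueryFn_encode (I : LatticeInstance) (d : ℚ) (i : Fin I.n) :
    lemmaA1QueryFn (boolPair (gapSVPInstanceEncoding.encode (I, d)) (List.replicate i true)) =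
      gapCVPInstanceEncoding.encode (gmssInstance I i, d) := by
  rw [lemmaA1QueryFn_boolPair, List.length_replicate, dimOf_encode, query_encode]

/-! ### The two `P` tests -/

/-- The in-range test `{⟨x, u⟩ | dimOf x ≤ |u|}` ("all `n` calls answered": index out of range).
[folklore] -/
def lemmaA1Done : Language Bool := {z | dimOf (fstP z) ≤ (sndP z).length}

/-- `lemmaA1Done ∈ P` (its indicator is the GMSS brick `doneTestFn` after re-pairing).
[cite: AroraBarak2009, §1.3] -/
theorem lemmaA1Done_mem_P : lemmaA1Done ∈ Classes.P := by
  refine mem_P_of_mem_FP (comp_mem_FP doneTestFn_mem_FP lemmaA1Repair_mem_FP) lemmaA1Done fun z => ?_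
  have hz : (doneTestFn ∘ lemmaA1Repair) z = [decide (dimOf (fstP z) ≤ (sndP z).length)] := by
    simp [lemmaA1Repair, doneTestFn, fstP, sndP]
  refine ⟨fun h => ?_, fun h => ?_⟩
  · rw [hz, decide_eq_true (show dimOf (fstP z) ≤ (sndP z).length from h)]
  · rw [hz, decide_eq_false (show ¬ dimOf (fstP z) ≤ (sndP z).length from h)]

/-- The dimension-zero test `{x | dimOf x = 0}`. [folklore] -/
def lemmaA1DimZero : Language Bool := {x | dimOf x = 0}

/-- `lemmaA1DimZero ∈ P` (its indicator is the GMSS brick `zeroTestFn` on `⟨x, []⟩`).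
[cite: AroraBarak2009, §1.3] -/
theorem lemmaA1DimZero_mem_P : lemmaA1DimZero ∈ Classes.P := by
  refine mem_P_of_mem_FP (comp_mem_FP zeroTestFn_mem_FP (pairFn_mem_FP OracleCompose.id_mem_FP (const_mem_FP [])))
    lemmaA1DimZero fun x => ?_
  have hx : (zeroTestFn ∘ pairFn id fun _ => ([] : List Bool)) x = [decide (dimOf x = 0)] := by
    simp [zeroTestFn]
  refine ⟨fun h => ?_, fun h => ?_⟩
  · rw [hx, decide_eq_true (show dimOf x = 0 from h)]
  · rw [hx, decide_eq_false (show ¬ dimOf x = 0 from h)]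

/-! ### Closure facts for `coNP` used -/

/-- `coNP` is closed under `FP` preimages. [cite: AroraBarak2009, Thm. 2.8] -/
theorem preimage_mem_coNP {K : Language Bool} (hK : K ∈ coNP) {f : List Bool → List Bool}
    (hf : f ∈ FP) : f ⁻¹' K ∈ coNP :=
  preimage_mem_co (K := Nondeterministic.NP) (fun _ hL _ hg => preimage_mem_NP hL hg) hK hf

/-- `coNP` absorbs intersections with `P` languages. [cite: AroraBarak2009, §2.1 and Ex. 2.10] -/
theorem inter_P_mem_coNP {L₁ L₂ : Language Bool} (h₁ : L₁ ∈ Classes.P) (h₂ : L₂ ∈ coNP) :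
    L₁ ⊓ L₂ ∈ coNP :=
  inter_P_mem_co (K := Nondeterministic.NP)
    (fun _ _ a b => union_P_mem_polyExists (K := Classes.P) (fun _ _ c d => union_mem_P c d) a b) h₁ h₂

/-- `coNP` absorbs unions with `P` languages. [cite: AroraBarak2009, §2.1 and Ex. 2.10] -/
theorem union_P_mem_coNP {L₁ L₂ : Language Bool} (h₁ : L₁ ∈ Classes.P) (h₂ : L₂ ∈ coNP) :
    L₁ ⊔ L₂ ∈ coNP :=
  union_P_mem_co (K := Nondeterministic.NP)
    (fun _ _ a b => inter_P_mem_polyExists (K := Classes.P) (fun _ _ c d => inter_mem_P c d) a b) h₁ h₂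

/-! ### The separating language -/

/-- The `coNP` language separating `GapSVP_γ`, built from a language `K` separating `GapCVP_γ`:
`{x | dimOf x = 0} ∪ {x | ∃ i < |x|, ¬ (dimOf x ≤ i) ∧ query x i (dimOf x) ∈ K}`.
[cite: AharonovRegev2005, Lemma A.1 (App. A, p. 14)] -/
def lemmaA1Lang (K : Language Bool) : Language Bool :=
  lemmaA1DimZero ⊔ bexLang X (lemmaA1Doneᶜ ⊓ lemmaA1QueryFn ⁻¹' K)

/-- **Machine-level content of Lemma A.1**: `lemmaA1Lang K ∈ coNP` for `K ∈ coNP` (witnesses of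
the `n` calls concatenate: `bexLang_mem_coNP`). [cite: AharonovRegev2005, Lemma A.1 (App. A, p. 14)] -/
theorem lemmaA1Lang_mem_coNP {K : Language Bool} (hK : K ∈ coNP) : lemmaA1Lang K ∈ coNP :=
  union_P_mem_coNP lemmaA1DimZero_mem_P
    (bexLang_mem_coNP X (inter_P_mem_coNP ((compl_mem_P_iff (L := lemmaA1Done)).2 lemmaA1Done_mem_P)
      (preimage_mem_coNP hK lemmaA1QueryFn_mem_FP)))

/-- Membership of a pair `⟨x, 1ⁱ⟩` in the inner language. [folklore] -/
theorem boolPair_replicate_mem_inner_iff (K : Language Bool) (x : List Bool) (i : ℕ) :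
    boolPair x (List.replicate i true) ∈ (lemmaA1Doneᶜ ⊓ lemmaA1QueryFn ⁻¹' K : Language Bool) ↔
      ¬ dimOf x ≤ i ∧ query x i (dimOf x) ∈ K := by
  change (¬ dimOf (fstP (boolPair x (List.replicate i true))) ≤
        (sndP (boolPair x (List.replicate i true))).length ∧
      lemmaA1QueryFn (boolPair x (List.replicate i true)) ∈ K) ↔ _
  rw [fstP_boolPair, sndP_boolPair, lemmaA1QueryFn_boolPair, List.length_replicate]

/-- **YES codes are accepted**: the code of a YES instance `(B, d)` of `GapSVP_γ` lies in
`lemmaA1Lang K` whenever `K` contains the codes of all YES instances of `GapCVP_γ` (dimension `0`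
by the first disjunct; otherwise some GMSS call is a YES instance, MR07 Lemma 5.22).
[cite: AharonovRegev2005, Lemma A.1 (App. A, p. 14)] -/
theorem encode_mem_lemmaA1Lang_of_yes {γ : ℕ → ℝ} {K : Language Bool}
    (hK : (gapCVPPromise γ).yes ≤ K) {I : LatticeInstance} {d : ℚ} (h : (I, d) ∈ GapSVP.yes γ) :
    gapSVPInstanceEncoding.encode (I, d) ∈ lemmaA1Lang K := by
  by_cases h0 : I.n = 0
  · left
    change dimOf (gapSVPInstanceEncoding.encode (I, d)) = 0
    rw [dimOf_encode, h0]
  · right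
    obtain ⟨i, hi⟩ := ((MicciancioRegev2007_lemma_5_22 γ I h0 d).1).1 h
    refine (mem_bexLang).2 ⟨i, ?_, ?_⟩
    · rw [eval_X]
      exact lt_of_lt_of_le i.isLt (n_le_length_encode_gapSVP I d)
    · rw [boolPair_replicate_mem_inner_iff, dimOf_encode, query_encode]
      refine ⟨not_le.2 i.isLt, hK ?_⟩
      rw [gapCVPPromise_yes]
      exact ⟨_, (GapCVP'.yes_eq_gapCVP_yes γ) ▸ hi, rfl⟩

/-- **NO codes are rejected** (for `γ(0) ≥ 0`): the code of a NO instance `(B, d)` of `GapSVP_γ`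
lies outside `lemmaA1Lang K` whenever `K` avoids the codes of all NO instances of `GapCVP_γ`
(positive dimension is forced; every in-range GMSS call is a NO instance, MR07 Lemma 5.22; the
range test excludes the other indices). [cite: AharonovRegev2005, Lemma A.1 (App. A, p. 14)] -/
theorem encode_not_mem_lemmaA1Lang_of_no {γ : ℕ → ℝ} (hγ : 0 ≤ γ 0) {K : Language Bool}
    (hK : (gapCVPPromise γ).no ≤ Kᶜ) {I : LatticeInstance} {d : ℚ} (h : (I, d) ∈ GapSVP.no γ) :
    gapSVPInstanceEncoding.encode (I, d) ∉ lemmaA1Lang K := by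
  have h0 : I.n ≠ 0 := fun h0 => not_mem_gapSVP_no_of_n_eq_zero γ hγ h0 d h
  rintro (hx | hx)
  · change dimOf (gapSVPInstanceEncoding.encode (I, d)) = 0 at hx
    rw [dimOf_encode] at hx
    exact h0 hx
  · obtain ⟨i, -, hi⟩ := (mem_bexLang).1 hx
    rw [boolPair_replicate_mem_inner_iff, dimOf_encode] at hi
    obtain ⟨hlt, hiK⟩ := hi
    have hin : i < I.n := lt_of_not_ge hlt
    rw [query_encode I d ⟨i, hin⟩] at hiK
    refine hK ?_ hiK
    rw [gapCVPPromise_no]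
    exact ⟨_, GapCVP'.no_subset_gapCVP_no γ ((MicciancioRegev2007_lemma_5_22 γ I h0 d).2 h ⟨i, hin⟩), rfl⟩

/-- In dimension `0` with `γ(0) < 0` the YES and NO languages of `GapCVP_γ` meet (the instance
`((∅, 0), 1)`), so no language separates them. [cite: MicciancioRegev2007, Def. 5.21 and Lemma 5.22 (authors' version p. 27)] -/
theorem gapCVPPromise_not_mem_promiseLift_of_neg {γ : ℕ → ℝ} (hγ : γ 0 < 0)
    (C : Set (Language Bool)) : gapCVPPromise γ ∉ promiseLift C := by
  rintro ⟨K, -, hy, hn⟩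
  let I₀ : LatticeInstance := ⟨0, Matrix.of fun _ _ => 0⟩
  have hno : (I₀, (1 : ℚ)) ∈ GapSVP.no γ := by
    refine ⟨isNonsingular_of_n_eq_zero rfl, one_pos, ?_⟩
    change γ I₀.n * ((1 : ℚ) : ℝ) < minNorm I₀.lattice
    rw [minNorm_eq_zero_of_n_eq_zero (I := I₀) rfl, Rat.cast_one, mul_one]
    exact hγ
  obtain ⟨hyes, hno'⟩ := exists_mem_gapCVP'_yes_and_no_of_n_eq_zero (I := I₀) rfl hno
  have hxK : gapCVPInstanceEncoding.encode ((⟨I₀, 0⟩ : CVPInstance), (1 : ℚ)) ∈ K :=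
    hy (by rw [gapCVPPromise_yes]; exact ⟨_, (GapCVP'.yes_eq_gapCVP_yes γ) ▸ hyes, rfl⟩)
  have hxK' : gapCVPInstanceEncoding.encode ((⟨I₀, 0⟩ : CVPInstance), (1 : ℚ)) ∈ Kᶜ :=
    hn (by rw [gapCVPPromise_no]; exact ⟨_, GapCVP'.no_subset_gapCVP_no γ hno', rfl⟩)
  exact hxK' hxK

/-! ### The discharge -/

/-- **Aharonov–Regev 2005, Lemma A.1** (`AharonovRegev2005_lemmaA1`, DISCHARGED): for every
factor `γ`, if `GapCVP_γ ∈ PromiseCoNP` then `GapSVP_γ ∈ PromiseCoNP`. For `γ(0) < 0` the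
hypothesis is contradictory (`gapCVPPromise_not_mem_promiseLift_of_neg`); otherwise the separating
language is `lemmaA1Lang K` for a `coNP` language `K` separating `GapCVP_γ`.
[cite: AharonovRegev2005, Lemma A.1 (App. A, p. 14)] -/
theorem AharonovRegev2005_lemmaA1_holds : AharonovRegev2005_lemmaA1 := by
  intro γ hco
  by_cases hγ : 0 ≤ γ 0
  · obtain ⟨K, hK, hy, hn⟩ := hco
    refine ⟨lemmaA1Lang K, lemmaA1Lang_mem_coNP hK, ?_, ?_⟩
    · rintro x hx
      rw [gapSVPPromise_yes] at hx
      obtain ⟨⟨I, d⟩, hp, rfl⟩ := hx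
      exact encode_mem_lemmaA1Lang_of_yes hy hp
    · rintro x hx
      rw [gapSVPPromise_no] at hx
      obtain ⟨⟨I, d⟩, hp, rfl⟩ := hx
      exact encode_not_mem_lemmaA1Lang_of_no hγ hn hp
  · exact absurd hco (gapCVPPromise_not_mem_promiseLift_of_neg (lt_of_not_ge hγ) _)

/-- **Cor. 1.2 from two leaves.** With Lemma A.1 discharged, Aharonov–Regev 2005, Cor. 1.2
(`gapSVP_sqrt_mem_promiseNP_inter_promiseCoNP`) follows from the NP leaf `gapSVP_mem_promiseNP`
and the coNP part of Thm. 1.1 `gapCVP_sqrt_mem_promiseCoNP` alone.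
[cite: AharonovRegev2005, Cor. 1.2 (p. 2), from Thm. 1.1 and Lemma A.1 (p. 14)] -/
theorem gapSVP_sqrt_mem_promiseNP_inter_promiseCoNP_of_NP_of_coNP (hNP : gapSVP_mem_promiseNP)
    (h11 : gapCVP_sqrt_mem_promiseCoNP) : gapSVP_sqrt_mem_promiseNP_inter_promiseCoNP :=
  gapSVP_sqrt_mem_promiseNP_inter_promiseCoNP_of hNP AharonovRegev2005_lemmaA1_holds h11

end Literature.Algebra.EuclideanLattices

end
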